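import Literature.Geometry.Symplectic.SymplecticSplittingReduction
import Literature.Geometry.Symplectic.GaussBonnetChernNumber
import HarnessLib

/-!
# `K² = 2χ + 3σ` and adjunction for closed symplectic four-manifolds, modulo Hirzebruch and the self-intersection formula

D. McDuff, D. Salamon, *Introduction to Symplectic Topology*, 3rd ed. (2017), Ex. 4.4.5 (adjunction),
Rem. 4.1.10 (`K² = 2χ + 3σ`), Thm. 2.7.1 / Thm. 2.7.5 (`c₁(TΣ) = 2 - 2g`, zeros of a section).

The tree's reduction `canonicalClass_sq_and_adjunction_of_symplectic_four_of_hirzebruch_of_adjunctionInputs`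
(`SymplecticSplittingReduction`) proves the named fact
`canonicalClass_sq_and_adjunction_of_symplectic_four` from the Hirzebruch–Wu input
`hirzebruch_firstChernClass_sq_eq_almostComplex_four` and, for every symplectic surface `S ⊂ N`, the
existence of a `ℤ`-orientation `μS` of `S` carrying BOTH `⟨c₁(TS, j), [S]_{μS}⟩ = 2 - b₁(S)` (GB) and
the self-intersection formula `⟨c₁(ν_S), [S]_{μS}⟩ = S·S` (SI).  (GB) is now PROVED
(`GaussBonnetChernNumber.exists_orientation_kroneckerPairing_chernClass_tangent_eq`) for the explicit
**Gauss–Bonnet orientation** `gbOrientation t = ∓(area orientation of t)` of a surface with a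
nondegenerate `2`-form `t` (the sign is the tree's universal normalisation unit `κ(μE)`,
`lineIndexUnit`), simultaneously for all `j` tamed by `t`.  This file records the sharpened reduction:

  `canonicalClass_sq_and_adjunction_of_symplectic_four` ⇐ (Hirzebruch–Wu) ∧ (SI for `gbOrientation (b^*ω)`)

(`canonicalClass_sq_and_adjunction_of_symplectic_four_of_hirzebruch_of_selfIntersection`), the
remaining input (SI) being McDuff–Salamon's "`c₁(νΣ) = Σ·Σ`" (Ex. 4.4.5 with Thm. 2.7.5; Milnor–Stasheff
1974 Thm. 11.3 / Problem 11-C: the Thom class of the normal bundle restricts to its Euler class) for the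
symplectic normal bundle `SymplecticSplitting.symplecticNormalBundle` and the Gauss–Bonnet orientation.

Everything here is proved; no named facts are introduced.

## References

* [McDuffSalamon2017] D. McDuff, D. Salamon, Introduction to Symplectic Topology, 3rd ed., OUP 2017,
  Thm. 2.7.1, Thm. 2.7.5, Rem. 4.1.10, Ex. 4.4.5.
* [MilnorStasheff1974] J. Milnor, J. Stasheff, Characteristic Classes, Thm. 11.3, Cor. 11.12.
-/

noncomputable section

open scoped Manifold ContDiff Topology
open Set Function Module
open Literature.Geometry.Kaehler (MForm IsSmoothForm IsClosedForm)
open Literature.AlgebraicTopology.SingularHomology Literature.AlgebraicTopology.CharacteristicClasses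
open Literature.Topology.FourManifolds Literature.Topology.FourManifolds.HomologicalOrientationOfSmooth

namespace Literature.Geometry.Symplectic

/-! ### The Gauss–Bonnet orientation of a surface with a nondegenerate `2`-form -/

section GB

variable {S : Type} [TopologicalSpace S] [T2Space S]
  [ChartedSpace (EuclideanSpace ℝ (Fin 2)) S] [IsManifold (𝓡 2) ∞ S]

open Classical in
/-- **The Gauss–Bonnet orientation** of a surface carrying a nondegenerate `2`-form `t`: `∓` its area
orientation `surfaceOrientation t`, the sign being the tree's universal normalisation unit
`κ(μE) = ±1` (`lineIndexUnit (μE 2)`), chosen so that `⟨c₁(TS, j), [S]⟩ = χ(S)` for every tamed `j`.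
[cite: McDuffSalamon2017, Thm. 2.7.1 (normalization) and Thm. 2.7.5] -/
def gbOrientation (t : MForm (𝓡 2) S ℝ 2) (ht : IsSmoothForm t)
    (hnd : ∀ y (v : TangentSpace (𝓡 2) y), v ≠ 0 → ∃ w : TangentSpace (𝓡 2) y, t y ![v, w] ≠ 0) :
    HomologicalOrientation ℤ S 2 :=
  if lineIndexUnit (μE 2) = 1 then -surfaceOrientation t ht hnd else surfaceOrientation t ht hnd

open Classical in
/-- Unfolding `gbOrientation`. [folklore] -/
theorem gbOrientation_def (t : MForm (𝓡 2) S ℝ 2) (ht : IsSmoothForm t)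
    (hnd : ∀ y (v : TangentSpace (𝓡 2) y), v ≠ 0 → ∃ w : TangentSpace (𝓡 2) y, t y ![v, w] ≠ 0) :
    gbOrientation t ht hnd =
      if lineIndexUnit (μE 2) = 1 then -surfaceOrientation t ht hnd else surfaceOrientation t ht hnd := rfl

/-- **`⟨c₁(TS, j), [S]_{GB}⟩ = χ(S) = 2 - rank H₁(S; ℤ)`** for the Gauss–Bonnet orientation of a closed
connected surface with a nondegenerate `2`-form `t` and EVERY almost complex structure `j` tamed by `t`
(`kroneckerPairing_chernClass_tangent_surfaceOrientation` with `relEuler_surface_eq_two_sub`).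
[cite: McDuffSalamon2017, Thm. 2.7.1 (normalization) and Thm. 2.7.5 eq. (2.7.1)] -/
theorem kroneckerPairing_chernClass_tangent_gbOrientation [CompactSpace S] [ConnectedSpace S] (t : MForm (𝓡 2) S ℝ 2)
    (ht : IsSmoothForm t)
    (hnd : ∀ y (v : TangentSpace (𝓡 2) y), v ≠ 0 → ∃ w : TangentSpace (𝓡 2) y, t y ![v, w] ≠ 0)
    (j : AlmostComplexStructure (𝓡 2) ∞ S) (hJ : j.IsTamedBy t) :
    kroneckerPairing ℤ ℤ S 2 (degCast ℤ (mul_one 2) (chernClassZ j.complexTangentBundle 1))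
        (gbOrientation t ht hnd).fundamentalClass =
      2 - (finrank ℤ (singularHomology ℤ ℤ S 1) : ℤ) := by
  have hχ := relEuler_surface_eq_two_sub (surfaceOrientation t ht hnd)
  rw [gbOrientation_def]
  split_ifs with hκ
  · rw [HomologicalOrientation.fundamentalClass_neg_holds (R := ℤ) (X := S) 2 _, map_neg,
      kroneckerPairing_chernClass_tangent_surfaceOrientation t ht hnd j hJ, hκ, one_mul, neg_neg, hχ]
  · have hκ' : lineIndexUnit (μE 2) = -1 := (lineIndexUnit_eq_one_or_eq_neg_one (μE 2)).resolve_left hκ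
    rw [kroneckerPairing_chernClass_tangent_surfaceOrientation t ht hnd j hJ, hκ', neg_one_mul, neg_neg, hχ]

end GB

/-! ### The reduction -/

section Reduction

variable {N : Type} [TopologicalSpace N] [ChartedSpace (EuclideanSpace ℝ (Fin 4)) N]
  {S : Type} [TopologicalSpace S] [ChartedSpace (EuclideanSpace ℝ (Fin 2)) S]

/-- The pulled-back form `b^*s` of a symplectic surface is nondegenerate. [cite: McDuffSalamon2017, §2.1] -/
theorem pullback_nondegenerate (s : MForm (𝓡 4) N ℝ 2) (b : S → N)
    (hbnd : ∀ y (v : TangentSpace (𝓡 2) y), v ≠ 0 → ∃ w : TangentSpace (𝓡 2) y,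
      s (b y) ![mfderiv (𝓡 2) (𝓡 4) b y v, mfderiv (𝓡 2) (𝓡 4) b y w] ≠ 0)
    (y : S) (v : TangentSpace (𝓡 2) y) (hv : v ≠ 0) :
    ∃ w : TangentSpace (𝓡 2) y, s.pullback (𝓡 2) b y ![v, w] ≠ 0 := by
  obtain ⟨w, hw⟩ := hbnd y v hv
  exact ⟨w, by rwa [pullback_apply_vecTwo]⟩

variable [IsManifold (𝓡 4) ∞ N] [IsManifold (𝓡 2) ∞ S]

/-- **The Gauss–Bonnet orientation of a symplectic surface `b : S ↪ (N, ω)`**: that of `b^*ω`.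
[cite: McDuffSalamon2017, Thm. 2.7.5 and Ex. 4.4.5] -/
def gbSurfaceOrientation [T2Space S] {s : MForm (𝓡 4) N ℝ 2} (hs : IsSmoothForm s)
    {b : S → N} (hb : Manifold.IsSmoothEmbedding (𝓡 2) (𝓡 4) ∞ b)
    (hbnd : ∀ y (v : TangentSpace (𝓡 2) y), v ≠ 0 → ∃ w : TangentSpace (𝓡 2) y,
      s (b y) ![mfderiv (𝓡 2) (𝓡 4) b y v, mfderiv (𝓡 2) (𝓡 4) b y w] ≠ 0) :
    HomologicalOrientation ℤ S 2 :=
  gbOrientation (s.pullback (𝓡 2) b) (Literature.NumberTheory.Transcendental.isSmoothForm_pullback hb.contMDiff hs)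
    (pullback_nondegenerate s b hbnd)

/-- **`K² = 2χ + 3σ` and adjunction for closed symplectic four-manifolds, from Hirzebruch–Wu and the
self-intersection formula for the Gauss–Bonnet orientation.**  The named fact
`canonicalClass_sq_and_adjunction_of_symplectic_four` follows from
(B) `hirzebruch_firstChernClass_sq_eq_almostComplex_four` (`c₁² = 2χ + 3σ`, MS Rem. 4.1.10 (4.1.7)) and
(SI) for every closed connected symplectic surface `b : S ↪ (N, ω)` of a closed symplectic four-manifold
with symplectic orientation `μ` and `ω`-compatible `J`: if `σ` is Poincaré dual to `b_*[S]_{GB}` for the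
Gauss–Bonnet orientation of `b^*ω`, then `⟨c₁(ν_S), [S]_{GB}⟩ = ⟨b^*σ, [S]_{GB}⟩ (= σ·σ)` for the
symplectic normal bundle `ν_S` (MS Ex. 4.4.5 with Thm. 2.7.5: "`c₁(νΣ) = Σ·Σ`").  The Gauss–Bonnet
input `⟨c₁(TS, j), [S]_{GB}⟩ = 2 - b₁(S)` of the earlier reduction is now the theorem
`kroneckerPairing_chernClass_tangent_gbOrientation`. [cite: McDuffSalamon2017, Ex. 4.4.5 eq. (4.4.5); Thm. 2.7.5; Rem. 4.1.10 eq. (4.1.7)] -/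
theorem canonicalClass_sq_and_adjunction_of_symplectic_four_of_hirzebruch_of_selfIntersection
    (hHW : hirzebruch_firstChernClass_sq_eq_almostComplex_four)
    (hSI : ∀ (N : Type) [TopologicalSpace N] [T2Space N] [SecondCountableTopology N]
      [CompactSpace N] [ConnectedSpace N] [ChartedSpace (EuclideanSpace ℝ (Fin 4)) N]
      [IsManifold (𝓡 4) ∞ N] (s : MForm (𝓡 4) N ℝ 2) (hs : IsSmoothForm s) (hcl : IsClosedForm s)
      (hsnd : ∀ x (v : TangentSpace (𝓡 4) x), v ≠ 0 → ∃ w : TangentSpace (𝓡 4) x, s x ![v, w] ≠ 0)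
      (μ : HomologicalOrientation ℤ N 4), μ.IsSymplecticOrientationOf s hs hcl →
      ∀ (J : AlmostComplexStructure (𝓡 4) ∞ N) (hJ : J.IsCompatibleWith s)
        (S : Type) [TopologicalSpace S] [CompactSpace S] [ConnectedSpace S]
        [ChartedSpace (EuclideanSpace ℝ (Fin 2)) S] [IsManifold (𝓡 2) ∞ S] [T2Space S] (b : S → N)
        (hb : Manifold.IsSmoothEmbedding (𝓡 2) (𝓡 4) ∞ b)
        (hbnd : ∀ y (v : TangentSpace (𝓡 2) y), v ≠ 0 → ∃ w : TangentSpace (𝓡 2) y,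
          s (b y) ![mfderiv (𝓡 2) (𝓡 4) b y v, mfderiv (𝓡 2) (𝓡 4) b y w] ≠ 0)
        (σ : ↥(singularCohomology ℤ ℤ N 2)),
        poincareDualityMap μ two_add_two_eq_four σ =
          singularHomology.map ℤ ℤ ⟨b, hb.isEmbedding.continuous⟩ 2 (gbSurfaceOrientation hs hb hbnd).fundamentalClass →
        kroneckerPairing ℤ ℤ S 2
            (degCast ℤ (mul_one 2) (chernClassZ
              (SymplecticSplitting.symplecticNormalBundle (IS := 𝓡 2) (J := J) (b := b) hs hsnd
                hJ.isTamedBy hb.contMDiff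
                (fun y ↦ (SymplecticSplitting.pullbackNondegAt_iff s b y).2 (hbnd y))
                finrank_euclideanSpace_four_eq_two_add_two) 1))
            (gbSurfaceOrientation hs hb hbnd).fundamentalClass =
          kroneckerPairing ℤ ℤ S 2 (singularCohomology.map ℤ ℤ ⟨b, hb.isEmbedding.continuous⟩ 2 σ)
            (gbSurfaceOrientation hs hb hbnd).fundamentalClass) :
    canonicalClass_sq_and_adjunction_of_symplectic_four := by
  refine canonicalClass_sq_and_adjunction_of_symplectic_four_of_hirzebruch_of_adjunctionInputs hHW ?_
  intro N _ _ _ _ _ _ _ s hs hcl hsnd μ hμ J hJ S _ _ _ _ _ _ b hb hbnd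
  refine ⟨gbSurfaceOrientation hs hb hbnd, fun j hj ↦ ?_, hSI N s hs hcl hsnd μ hμ J hJ S b hb hbnd⟩
  exact kroneckerPairing_chernClass_tangent_gbOrientation _ _ _ j hj.isTamedBy

end Reduction

end Literature.Geometry.Symplectic
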